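import Summits.QuantumFields.YangMills.Theorems.UnitScaleTiltProp7CornerCombLambdaClosure
import HarnessLib

/-!
# Route `UnitScaleTilt`, crux K1 «MinimiserStabilityRegPr» (stmt-QuantumFields-19200), route-R (β) (n3)-comb lane (II) ∕ `hMcomb₂` ⟸ H2-1(E) —
# FILE S «THE ANCHORED CLOSURE»: THE GAUGE LINE AND THE SOURCED LINE OF THE COMB CELL THEOREM CLOSE IN THE PURE B-SLOT,
# AND THE FULL-FIELD GRADIENT LINE `γ_l² ≤ BG²·((ρ⁻¹)^l)²` — THE SCALAR FORM OF THE DISPLAYED ROW (G_j)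

Cell `ym3-torus`, width seat `ym3-torus-px18` (gen 5); consumer rows: w3-20520 g12's FROZEN `h21E_of_rows` §3 v2 binder `hGc : ∀ j < l, GAPcell_j(Ỹ_j) ≤ Bg·Lʲ`
(the (G_j) slot of the H2-1(E) member knit feeding `hMcomb₂`) and the linear-response rows (hG)∕(hN′) of the (K2) knit.  THEOREMS ONLY (0 `def`, 0 `sorry`);
`--supports stmt-QuantumFields-19200 --as helper`, count-neutral.  Pure real analysis over ✓F-7c-1∕2∕3 (imported, nothing re-proved).  YM₃ on T³ is a ladder
rung (R3), not the Clay problem; nothing here claims `hMcomb`, `hMcomb₂`, (β), the stub, the crux, d = 4 or the mass gap.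
THE POINT (LOCATE `ym3-torus-px18/g5/LOCATE-GJ-SUPPLIER-px18g5.md`, 19200 evidence #60).  (G_j) must be PURE B-SLOT: `Bg` may carry GRAD₀-currency and `η²·MASS₀`
(`η = ℓ⁻¹`), never bare `MASS₀` (the `hMc₂`-envelope test).  ✓`n_lam_two_slot` books the source feed `aN = 2e′θ₂(M + cA)ρ∕(1−ρ²)` and the window-fed mass `cA` in the
A-SLOT, spending the top anchors `ρ^{2k₀+1}` (`top_feed_le_A`) and `ρ^{4(k₀−j)}` (`sum_kernel_winA_le`) — right for MASS, fatal for a gradient read crudely from it.  Keeping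
the anchors, every non-straight line is B-shaped: §1 ★`sum_kernel_winA_le_sharp` (`(ρʲ)²·ρ^{4(k₀−j)} = (ρ^{2k₀})²·((ρ⁻¹)ʲ)²` EXACTLY, `sq_anchor_eq`); §2 ★★★`lam_closure_sharp`
(`λ_j ≤ (cB0 + cA·ρ^{2k₀} + cB1·Q)·(ρ⁻¹)ʲ` under ✓`lam_closure`'s smallness and constant rows VERBATIM); §3 ★★★`n_lam_closure_sharp` (✓`n_closure` reused at
`(cB0, cA) := (cB0 + cAρ^{2k₀}, 0)`; `Qn♯ = 2e′θ₂(M·ρ^{2k₀+1}∕(1−ρ²) + (cB0 + cAρ^{2k₀})ρ³∕(1−ρ⁴))`); §4 ★★`n_lam_B_slot_of_rows` and ★★★`grad_full_B_slot_of_rows` — under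
F-8b-3 `full_two_slot_of_rows`' binder list VERBATIM plus the scalar full-gradient row `γ_j² ≤ uG·g_j² + uN·n_j² + uL·λ_j²` (inhabited at the member with
`(uG,uN,uL) = (4,16d,8d)` by ✓p716446 `sum_cell_covGrad_add_le` twice, `Ỹ = G̃lin + N + ∇^{cov}Λ`): `γ_l² ≤ (uG·Ĝ² + uN·Qn♯² + uL·(cB0 + cAρ^{2k} + cB1·Qn♯)²)·((ρ⁻¹)^l)²`,
`Ĝ = g₀ + θ_g e′m₀·ρ^{2k}ρ³∕(1−ρ²)`, `M = e′m₀` — on `T³` (`((ρ⁻¹)^l)² = Lˡ`, `ρ^{2k} = (Lᵏ)⁻¹`, §5) the (G_j) shape `GRADcov_cell(Ỹ_l) ≤ BG²·Lˡ`, `BG²` in {GRAD₀, η²MASS₀} × windows.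
HONEST SCOPE.  Elementary real analysis; every window ∕ smallness ∕ constant row is a hypothesis (discharged from `RegPr`∕`In19` by the F-8c-3 dictionary, as for `hMc`); the
member file (twin of F-8b-4 exporting the covariant-gradient cell sum, same displayed `hrow`) plugs in.  [folklore] bookkeeping behind [Balaban1987RG1] (0.1)∕(0.4)
pp.251–253 (the inductive level bounds on the gauge-field gradients) and [Balaban1985Averaging] Prop. 3 (122)–(126) p.36.
-/

set_option autoImplicit false

noncomputable section

open scoped BigOperators
open Finset

namespace Summit.QuantumFields.YangMills.Theorems.Prop7CornerCombLambdaClosureSharp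

open Summit.QuantumFields.YangMills.Theorems.Prop7CornerCombCoupledClosure (n_closure)
open Summit.QuantumFields.YangMills.Theorems.Prop7CornerCombLambdaClosure (geom_sum_le_inv_one_sub pow_five_div_le kernel_winA_term_eq
  sum_kernel_B_le sum_kernel_winB_le sq_le_sq_mul)
open Summit.QuantumFields.YangMills.Theorems.Prop7CornerCombLevelInduction (mass_line_le_geom grad_line_le_geom_sharp)

/-! ## §1 The anchor identity and the sharp window-fed kernel sum -/

/-- The anchor identity: `(ρʲ)²·ρ^{4(k₀−j)} = (ρ^{2k₀})²·((ρ⁻¹)ʲ)²` for `j ≤ k₀`, `ρ ≠ 0` — an A-shaped square times the decaying window IS a B-shaped square times the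
top anchor `ρ^{4k₀}`. [folklore] -/
theorem sq_anchor_eq {ρ : ℝ} (hρ : ρ ≠ 0) {j k₀ : ℕ} (hjk : j ≤ k₀) :
    (ρ ^ j) ^ 2 * ρ ^ (4 * (k₀ - j)) = (ρ ^ (2 * k₀)) ^ 2 * ((ρ⁻¹) ^ j) ^ 2 := by
  obtain ⟨s, rfl⟩ := Nat.exists_eq_add_of_le hjk
  rw [show 4 * (j + s - j) = 4 * s by omega]
  simp only [inv_pow]
  field_simp
  ring

/-- ★ **THE WINDOW-FED KERNEL SUM, SHARP**: `Σ_{i<j} (ρ⁻¹)^{j−i}·ρ^{4(k₀−i)}·(ρⁱ)² ≤ (ρ^{2k₀})²·((ρ⁻¹)ʲ)²·(ρ∕(1−ρ))` (`0 < ρ < 1`, `j ≤ k₀`) — ✓`sum_kernel_winA_le`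
WITHOUT spending the window `ρ^{4(k₀−j)} ≤ 1`: the A-shaped data of the gauge row, fed along the `(ρ⁻¹)^{j−i}` kernel with their decaying window, are B-shaped with the
top anchor `(ρ^{2k₀})²`. [folklore] -/
theorem sum_kernel_winA_le_sharp {ρ : ℝ} (hρ0 : 0 < ρ) (hρ1 : ρ < 1) {j k₀ : ℕ} (hjk : j ≤ k₀) :
    ∑ i ∈ Finset.range j, (ρ⁻¹) ^ (j - i) * ρ ^ (4 * (k₀ - i)) * (ρ ^ i) ^ 2
      ≤ (ρ ^ (2 * k₀)) ^ 2 * ((ρ⁻¹) ^ j) ^ 2 * (ρ / (1 - ρ)) := by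
  rw [Finset.sum_congr rfl fun i hi => kernel_winA_term_eq hρ0.ne' (Finset.mem_range.mp hi) hjk, ← Finset.mul_sum, ← Finset.mul_sum,
    Finset.sum_range_reflect (fun t => ρ ^ t) j]
  have hgeom := geom_sum_le_inv_one_sub hρ0.le hρ1 j
  have h0 : 0 ≤ (ρ ^ j) ^ 2 * ρ ^ (4 * (k₀ - j)) * ρ := by positivity
  calc (ρ ^ j) ^ 2 * (ρ ^ (4 * (k₀ - j)) * ρ * ∑ t ∈ Finset.range j, ρ ^ t)
      = ((ρ ^ j) ^ 2 * ρ ^ (4 * (k₀ - j)) * ρ) * ∑ t ∈ Finset.range j, ρ ^ t := by ring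
    _ ≤ ((ρ ^ j) ^ 2 * ρ ^ (4 * (k₀ - j)) * ρ) * (1 / (1 - ρ)) := mul_le_mul_of_nonneg_left hgeom h0
    _ = _ := by rw [sq_anchor_eq hρ0.ne' hjk]; ring

/-! ## §2 ★★★ The gauge line closed in the pure B-slot -/

/-- One summand of the gauge row with a PURE B-shaped bound on the lower `λ_i ≤ S·(ρ⁻¹)ⁱ` (✓`row_summand_le` with the λ-feedback read in one slot):
`… ≤ (wGĜ² + wNQ²)·((ρ⁻¹)ⁱ)² + ρ^{4(k₀−i)}·((ΘM + 3wSθ₂²)M²·(ρⁱ)² + ((ΘM + 3wSθ₂²)Q² + 3wSθ₂²S²)·((ρ⁻¹)ⁱ)²)`. [folklore] -/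
theorem row_summand_le_sharp {ρ θ₂ ΘM wG wN wS Ĝ M Q S gi ni mi li wMi σi : ℝ} (hρ0 : 0 < ρ) (hwG : 0 ≤ wG) (hwN : 0 ≤ wN) (hwS : 0 ≤ wS)
    (hgi : 0 ≤ gi) (hni : 0 ≤ ni) (hmi : 0 ≤ mi) (hli : 0 ≤ li) (hwMi : 0 ≤ wMi) (hσi : 0 ≤ σi) {i k₀ : ℕ}
    (hg : gi ≤ Ĝ * (ρ⁻¹) ^ i) (hn : ni ≤ Q * (ρ⁻¹) ^ i) (hm : mi ≤ M * ρ ^ i) (hl : li ≤ S * (ρ⁻¹) ^ i)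
    (hwM : wMi ≤ ΘM * ρ ^ (4 * (k₀ - i))) (hσ : σi ≤ θ₂ * ρ ^ (2 * (k₀ - i))) :
    wG * gi ^ 2 + wN * ni ^ 2 + wMi * (mi ^ 2 + ni ^ 2) + wS * σi ^ 2 * (mi + ni + li) ^ 2
      ≤ (wG * Ĝ ^ 2 + wN * Q ^ 2) * ((ρ⁻¹) ^ i) ^ 2
        + ρ ^ (4 * (k₀ - i)) * ((ΘM + 3 * wS * θ₂ ^ 2) * M ^ 2 * (ρ ^ i) ^ 2
            + ((ΘM + 3 * wS * θ₂ ^ 2) * Q ^ 2 + 3 * wS * θ₂ ^ 2 * S ^ 2) * ((ρ⁻¹) ^ i) ^ 2) := by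
  have hX0 : 0 ≤ ((ρ⁻¹) ^ i) ^ 2 := sq_nonneg _
  have hA0 : 0 ≤ (ρ ^ i) ^ 2 := sq_nonneg _
  have hW0 : 0 ≤ ρ ^ (4 * (k₀ - i)) := pow_nonneg hρ0.le _
  have hg2 : gi ^ 2 ≤ Ĝ ^ 2 * ((ρ⁻¹) ^ i) ^ 2 := sq_le_sq_mul hgi hg
  have hn2 : ni ^ 2 ≤ Q ^ 2 * ((ρ⁻¹) ^ i) ^ 2 := sq_le_sq_mul hni hn
  have hm2 : mi ^ 2 ≤ M ^ 2 * (ρ ^ i) ^ 2 := sq_le_sq_mul hmi hm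
  have hl2 : li ^ 2 ≤ S ^ 2 * ((ρ⁻¹) ^ i) ^ 2 := sq_le_sq_mul hli hl
  have hσ2 : σi ^ 2 ≤ θ₂ ^ 2 * ρ ^ (4 * (k₀ - i)) := by
    have := sq_le_sq_mul hσi hσ
    rw [← pow_mul, show 2 * (k₀ - i) * 2 = 4 * (k₀ - i) by ring] at this
    exact this
  have hy2 : (mi + ni + li) ^ 2 ≤ 3 * (M ^ 2 * (ρ ^ i) ^ 2 + Q ^ 2 * ((ρ⁻¹) ^ i) ^ 2 + S ^ 2 * ((ρ⁻¹) ^ i) ^ 2) := by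
    have : (mi + ni + li) ^ 2 ≤ 3 * (mi ^ 2 + ni ^ 2 + li ^ 2) := by
      nlinarith [sq_nonneg (mi - ni), sq_nonneg (ni - li), sq_nonneg (mi - li)]
    linarith
  have hy0 : 0 ≤ (mi + ni + li) ^ 2 := sq_nonneg _
  have p1 : wG * gi ^ 2 ≤ wG * (Ĝ ^ 2 * ((ρ⁻¹) ^ i) ^ 2) := mul_le_mul_of_nonneg_left hg2 hwG
  have p2 : wN * ni ^ 2 ≤ wN * (Q ^ 2 * ((ρ⁻¹) ^ i) ^ 2) := mul_le_mul_of_nonneg_left hn2 hwN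
  have p3 : wMi * (mi ^ 2 + ni ^ 2) ≤ (ΘM * ρ ^ (4 * (k₀ - i))) * (M ^ 2 * (ρ ^ i) ^ 2 + Q ^ 2 * ((ρ⁻¹) ^ i) ^ 2) :=
    mul_le_mul hwM (add_le_add hm2 hn2) (by positivity) (hwMi.trans hwM)
  have p4 : wS * σi ^ 2 * (mi + ni + li) ^ 2
      ≤ wS * (θ₂ ^ 2 * ρ ^ (4 * (k₀ - i))) * (3 * (M ^ 2 * (ρ ^ i) ^ 2 + Q ^ 2 * ((ρ⁻¹) ^ i) ^ 2 + S ^ 2 * ((ρ⁻¹) ^ i) ^ 2)) :=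
    mul_le_mul (mul_le_mul_of_nonneg_left hσ2 hwS) hy2 hy0 (by positivity)
  have hsum := add_le_add (add_le_add (add_le_add p1 p2) p3) p4
  refine hsum.trans (le_of_eq ?_)
  ring

/-- ★★★ **THE GAUGE LINE CLOSED IN THE PURE B-SLOT.**  HYPOTHESES — VERBATIM those of ✓`Prop7CornerCombLambdaClosure.lam_closure` (windows `σ wM`, sourceless lines
`m_j ≤ Mρʲ`, `g_j ≤ Ĝ(ρ⁻¹)ʲ`, the gauge row, the smallness `12wSθ₂²ρ∕(1−ρ) ≤ ½`, the constant rows `hcB0sq hcB1sq hcAsq`).  CONCLUSION (the shape of ✓`n_closure`'s `hfb` at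
`(cB0, cA) := (cB0 + cA·ρ^{2k₀}, 0)`): `∀ Q ≥ 0, ∀ j ≤ k₀, (∀ i<j, n_i ≤ Q(ρ⁻¹)ⁱ) → λ_j ≤ (cB0 + cA·ρ^{2k₀} + cB1·Q)·(ρ⁻¹)ʲ` — the window-fed mass datum sits in the B-slot WITH
its top anchor `ρ^{2k₀}` (`= η` on `T³`).  PROOF: ✓`lam_closure`'s strong induction with `S := cB0 + cAρ^{2k₀} + cB1Q`, §1's sharp kernel sum, and `3wSθ₂²ρ⁵∕(1−ρ⁵) ≤ ⅛`.
[Balaban1987RG1 (0.4) p.253 — the inductive hypothesis on the gauge-field gradients, scalar form, top-anchored] -/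
theorem lam_closure_sharp {ρ θ₂ ΘM wG wN wS Ĝ M cA cB0 cB1 : ℝ} (hρ0 : 0 < ρ) (hρ1 : ρ < 1) (hΘM : 0 ≤ ΘM) (hwG : 0 ≤ wG) (hwN : 0 ≤ wN)
    (hwS : 0 ≤ wS) (hcA : 0 ≤ cA) (hcB0 : 0 ≤ cB0) (hcB1 : 0 ≤ cB1) (σ n m g lam wM : ℕ → ℝ) (hσ : ∀ j, 0 ≤ σ j) (hn : ∀ j, 0 ≤ n j)
    (hm0 : ∀ j, 0 ≤ m j) (hg0 : ∀ j, 0 ≤ g j) (hlam : ∀ j, 0 ≤ lam j) (hwM0 : ∀ j, 0 ≤ wM j) {k₀ : ℕ}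
    (hσgeo : ∀ j < k₀, σ j ≤ θ₂ * ρ ^ (2 * (k₀ - j))) (hwMgeo : ∀ j < k₀, wM j ≤ ΘM * ρ ^ (4 * (k₀ - j)))
    (hm : ∀ j ≤ k₀, m j ≤ M * ρ ^ j) (hg : ∀ j ≤ k₀, g j ≤ Ĝ * (ρ⁻¹) ^ j)
    (hrow : ∀ j ≤ k₀, lam j ^ 2 ≤ ∑ i ∈ Finset.range j,
      (ρ⁻¹) ^ (j - i) * (wG * g i ^ 2 + wN * n i ^ 2 + wM i * (m i ^ 2 + n i ^ 2) + wS * σ i ^ 2 * (m i + n i + lam i) ^ 2))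
    (hsmallS : 12 * wS * θ₂ ^ 2 * (ρ / (1 - ρ)) ≤ 1 / 2)
    (hcB0sq : 2 * wG * Ĝ ^ 2 * (ρ / (1 - ρ)) ≤ cB0 ^ 2)
    (hcB1sq : 2 * (wN * (ρ / (1 - ρ)) + (ΘM + 3 * wS * θ₂ ^ 2) * (ρ ^ 5 / (1 - ρ ^ 5))) ≤ cB1 ^ 2)
    (hcAsq : 2 * ((ΘM + 3 * wS * θ₂ ^ 2) * M ^ 2) * (ρ / (1 - ρ)) ≤ cA ^ 2) :
    ∀ Q : ℝ, 0 ≤ Q → ∀ j ≤ k₀, (∀ i < j, n i ≤ Q * (ρ⁻¹) ^ i) → lam j ≤ (cB0 + cA * ρ ^ (2 * k₀) + cB1 * Q) * (ρ⁻¹) ^ j := by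
  intro Q hQ j
  induction j using Nat.strong_induction_on with
  | _ j ih =>
    intro hj hQn
    have hρk : 0 ≤ ρ ^ (2 * k₀) := pow_nonneg hρ0.le _
    have hS0 : 0 ≤ cB0 + cA * ρ ^ (2 * k₀) + cB1 * Q := by positivity
    have hih : ∀ i < j, lam i ≤ (cB0 + cA * ρ ^ (2 * k₀) + cB1 * Q) * (ρ⁻¹) ^ i :=
      fun i hi => ih i hi (by omega) fun i' hi' => hQn i' (lt_trans hi' hi)
    have hB := sum_kernel_B_le hρ0 hρ1 j
    have hWA := sum_kernel_winA_le_sharp hρ0 hρ1 hj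
    have hWB := sum_kernel_winB_le hρ0 hρ1 hj
    -- the three coefficient groups of the summand bound
    obtain ⟨S, hS⟩ : ∃ S : ℝ, S = cB0 + cA * ρ ^ (2 * k₀) + cB1 * Q := ⟨_, rfl⟩
    rw [← hS] at hih hS0 ⊢
    obtain ⟨c₁, hc₁⟩ : ∃ c : ℝ, c = wG * Ĝ ^ 2 + wN * Q ^ 2 := ⟨_, rfl⟩
    obtain ⟨c₂, hc₂⟩ : ∃ c : ℝ, c = (ΘM + 3 * wS * θ₂ ^ 2) * M ^ 2 := ⟨_, rfl⟩
    obtain ⟨c₃, hc₃⟩ : ∃ c : ℝ, c = (ΘM + 3 * wS * θ₂ ^ 2) * Q ^ 2 + 3 * wS * θ₂ ^ 2 * S ^ 2 := ⟨_, rfl⟩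
    have hc₁0 : 0 ≤ c₁ := by rw [hc₁]; positivity
    have hc₂0 : 0 ≤ c₂ := by rw [hc₂]; positivity
    have hc₃0 : 0 ≤ c₃ := by rw [hc₃]; positivity
    have hterm : ∀ i ∈ Finset.range j,
        (ρ⁻¹) ^ (j - i) * (wG * g i ^ 2 + wN * n i ^ 2 + wM i * (m i ^ 2 + n i ^ 2) + wS * σ i ^ 2 * (m i + n i + lam i) ^ 2)
          ≤ c₁ * ((ρ⁻¹) ^ (j - i) * ((ρ⁻¹) ^ i) ^ 2) + c₂ * ((ρ⁻¹) ^ (j - i) * ρ ^ (4 * (k₀ - i)) * (ρ ^ i) ^ 2)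
            + c₃ * ((ρ⁻¹) ^ (j - i) * ρ ^ (4 * (k₀ - i)) * ((ρ⁻¹) ^ i) ^ 2) := by
      intro i hi
      have hij := Finset.mem_range.mp hi
      have hs := row_summand_le_sharp hρ0 hwG hwN hwS (hg0 i) (hn i) (hm0 i) (hlam i) (hwM0 i) (hσ i)
        (hg i (by omega)) (hQn i hij) (hm i (by omega)) (hih i hij) (hwMgeo i (by omega)) (hσgeo i (by omega))
      have hk0 : 0 ≤ (ρ⁻¹) ^ (j - i) := by positivity
      calc (ρ⁻¹) ^ (j - i) * (wG * g i ^ 2 + wN * n i ^ 2 + wM i * (m i ^ 2 + n i ^ 2) + wS * σ i ^ 2 * (m i + n i + lam i) ^ 2)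
          ≤ (ρ⁻¹) ^ (j - i) * ((wG * Ĝ ^ 2 + wN * Q ^ 2) * ((ρ⁻¹) ^ i) ^ 2
              + ρ ^ (4 * (k₀ - i)) * ((ΘM + 3 * wS * θ₂ ^ 2) * M ^ 2 * (ρ ^ i) ^ 2
                + ((ΘM + 3 * wS * θ₂ ^ 2) * Q ^ 2 + 3 * wS * θ₂ ^ 2 * S ^ 2) * ((ρ⁻¹) ^ i) ^ 2)) :=
            mul_le_mul_of_nonneg_left hs hk0
        _ = _ := by rw [hc₁, hc₂, hc₃]; ring
    have hsum : lam j ^ 2 ≤ c₁ * (((ρ⁻¹) ^ j) ^ 2 * (ρ / (1 - ρ))) + c₂ * ((ρ ^ (2 * k₀)) ^ 2 * ((ρ⁻¹) ^ j) ^ 2 * (ρ / (1 - ρ)))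
        + c₃ * (((ρ⁻¹) ^ j) ^ 2 * (ρ ^ 5 / (1 - ρ ^ 5))) := by
      calc lam j ^ 2 ≤ _ := hrow j hj
        _ ≤ ∑ i ∈ Finset.range j, (c₁ * ((ρ⁻¹) ^ (j - i) * ((ρ⁻¹) ^ i) ^ 2) + c₂ * ((ρ⁻¹) ^ (j - i) * ρ ^ (4 * (k₀ - i)) * (ρ ^ i) ^ 2)
            + c₃ * ((ρ⁻¹) ^ (j - i) * ρ ^ (4 * (k₀ - i)) * ((ρ⁻¹) ^ i) ^ 2)) := Finset.sum_le_sum hterm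
        _ = c₁ * ∑ i ∈ Finset.range j, (ρ⁻¹) ^ (j - i) * ((ρ⁻¹) ^ i) ^ 2
            + c₂ * ∑ i ∈ Finset.range j, (ρ⁻¹) ^ (j - i) * ρ ^ (4 * (k₀ - i)) * (ρ ^ i) ^ 2
            + c₃ * ∑ i ∈ Finset.range j, (ρ⁻¹) ^ (j - i) * ρ ^ (4 * (k₀ - i)) * ((ρ⁻¹) ^ i) ^ 2 := by
          rw [Finset.sum_add_distrib, Finset.sum_add_distrib, ← Finset.mul_sum, ← Finset.mul_sum, ← Finset.mul_sum]
        _ ≤ _ := add_le_add (add_le_add (mul_le_mul_of_nonneg_left hB hc₁0) (mul_le_mul_of_nonneg_left hWA hc₂0))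
              (mul_le_mul_of_nonneg_left hWB hc₃0)
    have hρlt : ρ ^ 5 < 1 := pow_lt_one₀ hρ0.le hρ1 (by norm_num)
    have hr0 : 0 ≤ ρ / (1 - ρ) := div_nonneg hρ0.le (by linarith)
    have h51 : ρ ^ 5 / (1 - ρ ^ 5) ≤ ρ / (1 - ρ) := pow_five_div_le hρ0.le hρ1
    have h50 : 0 ≤ ρ ^ 5 / (1 - ρ ^ 5) := div_nonneg (pow_nonneg hρ0.le 5) (by linarith)
    -- letters for the two kernels, the anchor and the B-square
    obtain ⟨r, hr⟩ : ∃ r : ℝ, r = ρ / (1 - ρ) := ⟨_, rfl⟩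
    obtain ⟨r₅, hr₅⟩ : ∃ r₅ : ℝ, r₅ = ρ ^ 5 / (1 - ρ ^ 5) := ⟨_, rfl⟩
    obtain ⟨W, hW⟩ : ∃ W : ℝ, W = (ρ ^ (2 * k₀)) ^ 2 := ⟨_, rfl⟩
    obtain ⟨X, hX⟩ : ∃ X : ℝ, X = ((ρ⁻¹) ^ j) ^ 2 := ⟨_, rfl⟩
    rw [← hr] at hsmallS hcB0sq hcB1sq hcAsq hr0 h51 hsum
    rw [← hr₅] at hcB1sq h51 h50 hsum
    rw [← hW, ← hX] at hsum
    have hX0 : 0 ≤ X := by rw [hX]; positivity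
    have hW0 : 0 ≤ W := by rw [hW]; positivity
    have hS2 : cB0 ^ 2 + cA ^ 2 * W + cB1 ^ 2 * Q ^ 2 ≤ S ^ 2 := by
      have hx : 0 ≤ cB0 * (cA * ρ ^ (2 * k₀)) + cB0 * (cB1 * Q) + (cA * ρ ^ (2 * k₀)) * (cB1 * Q) := by positivity
      have e : S ^ 2 = cB0 ^ 2 + cA ^ 2 * W + cB1 ^ 2 * Q ^ 2 + 2 * (cB0 * (cA * ρ ^ (2 * k₀)) + cB0 * (cB1 * Q) + (cA * ρ ^ (2 * k₀)) * (cB1 * Q)) := by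
        rw [hS, hW]; ring
      linarith
    have hSS : 0 ≤ S ^ 2 := sq_nonneg S
    have a3 : 3 * wS * θ₂ ^ 2 * r ≤ 1 / 8 := by linarith
    have a3' : 3 * wS * θ₂ ^ 2 * r₅ ≤ 1 / 8 := by
      have := mul_le_mul_of_nonneg_left h51 (by positivity : (0 : ℝ) ≤ 3 * wS * θ₂ ^ 2)
      linarith
    have hmain : c₁ * r + c₂ * (W * r) + c₃ * r₅ ≤ S ^ 2 := by
      have a1 : wG * Ĝ ^ 2 * r ≤ cB0 ^ 2 / 2 := by linarith
      have a2 : wN * Q ^ 2 * r + (ΘM + 3 * wS * θ₂ ^ 2) * Q ^ 2 * r₅ ≤ cB1 ^ 2 * Q ^ 2 / 2 := by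
        have h := mul_le_mul_of_nonneg_left hcB1sq (sq_nonneg Q)
        have e : Q ^ 2 * (2 * (wN * r + (ΘM + 3 * wS * θ₂ ^ 2) * r₅)) = 2 * (wN * Q ^ 2 * r + (ΘM + 3 * wS * θ₂ ^ 2) * Q ^ 2 * r₅) := by ring
        have e' : Q ^ 2 * cB1 ^ 2 = cB1 ^ 2 * Q ^ 2 := by ring
        linarith
      have a4 : c₂ * (W * r) ≤ cA ^ 2 * W / 2 := by
        have h := mul_le_mul_of_nonneg_left hcAsq hW0
        have e : W * (2 * ((ΘM + 3 * wS * θ₂ ^ 2) * M ^ 2) * r) = 2 * (c₂ * (W * r)) := by rw [hc₂]; ring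
        have e' : W * cA ^ 2 = cA ^ 2 * W := by ring
        linarith
      have a5 : 3 * wS * θ₂ ^ 2 * S ^ 2 * r₅ ≤ S ^ 2 / 8 := by
        have h := mul_le_mul_of_nonneg_left a3' hSS
        have e : S ^ 2 * (3 * wS * θ₂ ^ 2 * r₅) = 3 * wS * θ₂ ^ 2 * S ^ 2 * r₅ := by ring
        linarith
      have e : c₁ * r + c₂ * (W * r) + c₃ * r₅
          = wG * Ĝ ^ 2 * r + (wN * Q ^ 2 * r + (ΘM + 3 * wS * θ₂ ^ 2) * Q ^ 2 * r₅) + c₂ * (W * r) + 3 * wS * θ₂ ^ 2 * S ^ 2 * r₅ := by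
        rw [hc₁, hc₃]; ring
      rw [e]
      linarith
    have hfin : lam j ^ 2 ≤ (S * (ρ⁻¹) ^ j) ^ 2 := by
      have h1 : c₁ * (X * r) + c₂ * (W * X * r) + c₃ * (X * r₅) = (c₁ * r + c₂ * (W * r) + c₃ * r₅) * X := by ring
      have e : (S * (ρ⁻¹) ^ j) ^ 2 = S ^ 2 * X := by rw [hX]; ring
      rw [e]
      calc lam j ^ 2 ≤ _ := hsum
        _ = _ := h1
        _ ≤ S ^ 2 * X := mul_le_mul_of_nonneg_right hmain hX0
    have hSj : 0 ≤ S * (ρ⁻¹) ^ j := by positivity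
    have hsq := Real.sqrt_le_sqrt hfin
    rwa [Real.sqrt_sq (hlam j), Real.sqrt_sq hSj] at hsq

/-! ## §3 ★★★ The coupled tower closed with every anchor kept -/

/-- ★★★ **THE COUPLED COMB TOWER CLOSED, SHARP** (✓`Prop7CornerCombCoupledClosure.n_closure` REUSED VERBATIM at `(cB0, cA) := (cB0 + cA·ρ^{2k₀}, 0)` ∘ `lam_closure_sharp`).
Under the hypotheses of ✓`Prop7CornerCombLambdaClosure.n_lam_closure` VERBATIM — the sourced mass recursion `n_{j+1} ≤ (ρ + κ′_j)n_j + σ_j(m_j + n_j + λ_j)`, `n_0 = 0`,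
the gauge row, the windows `κ′ σ wM`, the sourceless lines `m g`, the two smallnesses `exp(θ′ρ³∕(1−ρ⁴))·θ₂·(1 + cB1)·ρ³∕(1−ρ⁴) ≤ ½`, `12wSθ₂²·ρ∕(1−ρ) ≤ ½`, and the
constant rows `hcB0sq hcB1sq hcAsq` — for every `j ≤ k₀`:
`n_j ≤ Qn♯·(ρ⁻¹)^j` and `λ_j ≤ (cB0 + cA·ρ^{2k₀} + cB1·Qn♯)·(ρ⁻¹)^j`, `Qn♯ = 2exp(θ′ρ³∕(1−ρ⁴))·θ₂·(M·ρ^{2k₀+1}∕(1−ρ²) + (cB0 + cA·ρ^{2k₀})·ρ³∕(1−ρ⁴))`.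
NO A-SLOT TERM: `M` appears only with its top anchor `ρ^{2k₀+1}`, `cA` only with `ρ^{2k₀}`. [Balaban1987RG1 (0.1)∕(0.4) pp.251–253, scalar form] -/
theorem n_lam_closure_sharp {ρ θ' θ₂ ΘM wG wN wS Ĝ M cA cB0 cB1 : ℝ} (hρ0 : 0 < ρ) (hρ1 : ρ < 1) (hθ' : 0 ≤ θ') (hθ₂ : 0 ≤ θ₂) (hΘM : 0 ≤ ΘM)
    (hwG : 0 ≤ wG) (hwN : 0 ≤ wN) (hwS : 0 ≤ wS) (hM : 0 ≤ M) (hcA : 0 ≤ cA) (hcB0 : 0 ≤ cB0) (hcB1 : 0 ≤ cB1)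
    (κ' σ n m g lam wM : ℕ → ℝ) (hκ' : ∀ j, 0 ≤ κ' j) (hσ : ∀ j, 0 ≤ σ j) (hn : ∀ j, 0 ≤ n j) (hm0 : ∀ j, 0 ≤ m j) (hg0 : ∀ j, 0 ≤ g j)
    (hlam : ∀ j, 0 ≤ lam j) (hwM0 : ∀ j, 0 ≤ wM j) {k₀ : ℕ}
    (hκ'geo : ∀ j < k₀, κ' j ≤ θ' * ρ ^ (4 * (k₀ - j))) (hσgeo : ∀ j < k₀, σ j ≤ θ₂ * ρ ^ (2 * (k₀ - j)))
    (hwMgeo : ∀ j < k₀, wM j ≤ ΘM * ρ ^ (4 * (k₀ - j)))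
    (hm : ∀ j ≤ k₀, m j ≤ M * ρ ^ j) (hg : ∀ j ≤ k₀, g j ≤ Ĝ * (ρ⁻¹) ^ j) (hn0 : n 0 = 0)
    (hrec : ∀ j < k₀, n (j + 1) ≤ (ρ + κ' j) * n j + σ j * (m j + n j + lam j))
    (hrow : ∀ j ≤ k₀, lam j ^ 2 ≤ ∑ i ∈ Finset.range j,
      (ρ⁻¹) ^ (j - i) * (wG * g i ^ 2 + wN * n i ^ 2 + wM i * (m i ^ 2 + n i ^ 2) + wS * σ i ^ 2 * (m i + n i + lam i) ^ 2))
    (hsmall : Real.exp (θ' * (ρ ^ 3 / (1 - ρ ^ 4))) * θ₂ * (1 + cB1) * (ρ ^ 3 / (1 - ρ ^ 4)) ≤ 1 / 2)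
    (hsmallS : 12 * wS * θ₂ ^ 2 * (ρ / (1 - ρ)) ≤ 1 / 2)
    (hcB0sq : 2 * wG * Ĝ ^ 2 * (ρ / (1 - ρ)) ≤ cB0 ^ 2)
    (hcB1sq : 2 * (wN * (ρ / (1 - ρ)) + (ΘM + 3 * wS * θ₂ ^ 2) * (ρ ^ 5 / (1 - ρ ^ 5))) ≤ cB1 ^ 2)
    (hcAsq : 2 * ((ΘM + 3 * wS * θ₂ ^ 2) * M ^ 2) * (ρ / (1 - ρ)) ≤ cA ^ 2) :
    ∀ j ≤ k₀,
      n j ≤ (2 * Real.exp (θ' * (ρ ^ 3 / (1 - ρ ^ 4))) * θ₂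
              * (M * (ρ ^ (2 * k₀ + 1) / (1 - ρ ^ 2)) + (cB0 + cA * ρ ^ (2 * k₀)) * (ρ ^ 3 / (1 - ρ ^ 4)))) * (ρ⁻¹) ^ j
        ∧ lam j ≤ (cB0 + cA * ρ ^ (2 * k₀) + cB1 * (2 * Real.exp (θ' * (ρ ^ 3 / (1 - ρ ^ 4))) * θ₂
              * (M * (ρ ^ (2 * k₀ + 1) / (1 - ρ ^ 2)) + (cB0 + cA * ρ ^ (2 * k₀)) * (ρ ^ 3 / (1 - ρ ^ 4))))) * (ρ⁻¹) ^ j := by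
  have hfb0 := lam_closure_sharp hρ0 hρ1 hΘM hwG hwN hwS hcA hcB0 hcB1 σ n m g lam wM hσ hn hm0 hg0 hlam hwM0 hσgeo hwMgeo hm hg hrow hsmallS
    hcB0sq hcB1sq hcAsq
  have hfb : ∀ Q : ℝ, 0 ≤ Q → ∀ j ≤ k₀, (∀ i < j, n i ≤ Q * (ρ⁻¹) ^ i) →
      lam j ≤ ((cB0 + cA * ρ ^ (2 * k₀)) + cB1 * Q) * (ρ⁻¹) ^ j + 0 * ρ ^ j := fun Q hQ j hj h => by
    rw [zero_mul, add_zero]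
    exact hfb0 Q hQ j hj h
  have hρk : 0 ≤ ρ ^ (2 * k₀) := pow_nonneg hρ0.le _
  have hcB0' : 0 ≤ cB0 + cA * ρ ^ (2 * k₀) := by positivity
  have hnb := n_closure hρ0 hρ1 hθ' hθ₂ hM (le_refl (0 : ℝ)) hcB0' hcB1 κ' σ n m lam hκ' hσ hn hm0 hlam hκ'geo hσgeo hm hn0 hrec hfb hsmall
  simp only [add_zero] at hnb
  have hρ2 : ρ ^ 2 < 1 := pow_lt_one₀ hρ0.le hρ1 (by norm_num)
  have hρ4 : ρ ^ 4 < 1 := pow_lt_one₀ hρ0.le hρ1 (by norm_num)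
  have h12 : 0 < 1 - ρ ^ 2 := by linarith
  have h14 : 0 < 1 - ρ ^ 4 := by linarith
  have hQ0 : 0 ≤ 2 * Real.exp (θ' * (ρ ^ 3 / (1 - ρ ^ 4))) * θ₂
      * (M * (ρ ^ (2 * k₀ + 1) / (1 - ρ ^ 2)) + (cB0 + cA * ρ ^ (2 * k₀)) * (ρ ^ 3 / (1 - ρ ^ 4))) := by positivity
  intro j hj
  refine ⟨hnb j hj, ?_⟩
  have := hfb _ hQ0 j hj fun i hi => hnb i (by omega)
  rw [zero_mul, add_zero] at this
  exact this

/-! ## §4 ★★★ From the rows of the split comb tower: the full-field gradient line in the pure B-slot -/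

/-- The sharp gradient feed read in B-shape KEEPING the top anchor: `ρ^{4k+3−3l} ≤ ρ^{2k}·(ρ³·(ρ⁻¹)^l)` (`l ≤ k`, `0 < ρ < 1`). [folklore] -/
private theorem pow_feed_le_anchor {ρ : ℝ} (hρ0 : 0 < ρ) (hρ1 : ρ < 1) {l k : ℕ} (hl : l ≤ k) :
    ρ ^ (4 * k + 3 - 3 * l) ≤ ρ ^ (2 * k) * (ρ ^ 3 * (ρ⁻¹) ^ l) := by
  have hρl : 0 < ρ ^ l := pow_pos hρ0 l
  rw [inv_pow, ← mul_assoc, ← pow_add, ← div_eq_mul_inv, le_div_iff₀ hρl, ← pow_add]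
  exact pow_le_pow_of_le_one hρ0.le hρ1.le (by omega)

/-- From `x ≤ C·u`, `0 ≤ x`, `0 ≤ w`: `w·x² ≤ w·C²·u²`. [folklore] -/
private theorem weight_sq_le {x C u w : ℝ} (hx : 0 ≤ x) (hw : 0 ≤ w) (h : x ≤ C * u) : w * x ^ 2 ≤ w * C ^ 2 * u ^ 2 := by
  have := mul_le_mul_of_nonneg_left (sq_le_sq_mul hx h) hw
  linarith [this]

/-- ★★ **THE PURE-B `n`∕`λ` LINES FROM THE ROWS.**  Under the binder list of F-8b-3 `full_two_slot_of_rows` VERBATIM — reals `0 < ρ < 1`; nonnegative letters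
`θ′ θ_g θ₂ ΘM wG wN wS cA cB0 cB1`; nonnegative sequences `κ′ K σ m n g y lam wM` on the levels `j ≤ k`; ROWS `m (j+1) ≤ (ρ + κ′ j)·m j`, `g (j+1) ≤ ρ⁻¹·g j + K j·m j`,
`n (j+1) ≤ (ρ + κ′ j)·n j + σ j·y j`, `n 0 = 0`, `y j ≤ m j + n j + lam j`, the gauge row; WINDOWS `κ′ j, K j ≤ θ·ρ^{4(k−j)}`, `σ j ≤ θ₂ρ^{2(k−j)}`, `wM j ≤ ΘM·ρ^{4(k−j)}`;
SMALLNESS∕CONSTANTS at `M := e′·m 0`, `Ĝ := g 0 + θ_g·e′·m 0·ρ^{2k}·ρ³∕(1−ρ²)`, `e′ = exp(θ′ρ³∕(1−ρ⁴))` — for every `l ≤ k`: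
`g l ≤ Ĝ·(ρ⁻¹)^l`, `n l ≤ Qn♯·(ρ⁻¹)^l`, `lam l ≤ (cB0 + cA·ρ^{2k} + cB1·Qn♯)·(ρ⁻¹)^l` with `Qn♯ = 2e′θ₂·(e′m₀·ρ^{2k+1}∕(1−ρ²) + (cB0 + cAρ^{2k})·ρ³∕(1−ρ⁴))`.
(The `N ≡ 0` reading — `σ ≡ 0`, datum `A♯` — is the linear-response tower of the (K2) rows (hG)∕(hN′).) [Balaban1987RG1 (0.1)∕(0.4) pp.251–253, scalar form] -/
theorem n_lam_B_slot_of_rows {ρ θ' θg θ₂ ΘM wG wN wS cA cB0 cB1 : ℝ} (hρ0 : 0 < ρ) (hρ1 : ρ < 1) (hθ' : 0 ≤ θ') (hθg : 0 ≤ θg) (hθ₂ : 0 ≤ θ₂)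
    (hΘM : 0 ≤ ΘM) (hwG : 0 ≤ wG) (hwN : 0 ≤ wN) (hwS : 0 ≤ wS) (hcA : 0 ≤ cA) (hcB0 : 0 ≤ cB0) (hcB1 : 0 ≤ cB1)
    (κ' K σ m n g y lam wM : ℕ → ℝ) (hκ' : ∀ j, 0 ≤ κ' j) (hK : ∀ j, 0 ≤ K j) (hσ : ∀ j, 0 ≤ σ j) (hm0 : ∀ j, 0 ≤ m j) (hn : ∀ j, 0 ≤ n j)
    (hg0 : ∀ j, 0 ≤ g j) (hlam : ∀ j, 0 ≤ lam j) (hwM0 : ∀ j, 0 ≤ wM j) {k : ℕ}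
    (hκ'geo : ∀ j < k, κ' j ≤ θ' * ρ ^ (4 * (k - j))) (hKgeo : ∀ j < k, K j ≤ θg * ρ ^ (4 * (k - j)))
    (hσgeo : ∀ j < k, σ j ≤ θ₂ * ρ ^ (2 * (k - j))) (hwMgeo : ∀ j < k, wM j ≤ ΘM * ρ ^ (4 * (k - j)))
    (hmrec : ∀ j < k, m (j + 1) ≤ (ρ + κ' j) * m j) (hgrec : ∀ j < k, g (j + 1) ≤ ρ⁻¹ * g j + K j * m j)
    (hn0 : n 0 = 0) (hnrec : ∀ j < k, n (j + 1) ≤ (ρ + κ' j) * n j + σ j * y j) (hy : ∀ j ≤ k, y j ≤ m j + n j + lam j)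
    (hrow : ∀ j ≤ k, lam j ^ 2 ≤ ∑ i ∈ Finset.range j,
      (ρ⁻¹) ^ (j - i) * (wG * g i ^ 2 + wN * n i ^ 2 + wM i * (m i ^ 2 + n i ^ 2) + wS * σ i ^ 2 * (m i + n i + lam i) ^ 2))
    (hsmall : Real.exp (θ' * (ρ ^ 3 / (1 - ρ ^ 4))) * θ₂ * (1 + cB1) * (ρ ^ 3 / (1 - ρ ^ 4)) ≤ 1 / 2)
    (hsmallS : 12 * wS * θ₂ ^ 2 * (ρ / (1 - ρ)) ≤ 1 / 2)
    (hcB0sq : 2 * wG * (g 0 + θg * Real.exp (θ' * (ρ ^ 3 / (1 - ρ ^ 4))) * m 0 * ρ ^ (2 * k) * (ρ ^ 3 / (1 - ρ ^ 2))) ^ 2 * (ρ / (1 - ρ)) ≤ cB0 ^ 2)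
    (hcB1sq : 2 * (wN * (ρ / (1 - ρ)) + (ΘM + 3 * wS * θ₂ ^ 2) * (ρ ^ 5 / (1 - ρ ^ 5))) ≤ cB1 ^ 2)
    (hcAsq : 2 * ((ΘM + 3 * wS * θ₂ ^ 2) * (Real.exp (θ' * (ρ ^ 3 / (1 - ρ ^ 4))) * m 0) ^ 2) * (ρ / (1 - ρ)) ≤ cA ^ 2) :
    ∀ l ≤ k,
      g l ≤ (g 0 + θg * Real.exp (θ' * (ρ ^ 3 / (1 - ρ ^ 4))) * m 0 * ρ ^ (2 * k) * (ρ ^ 3 / (1 - ρ ^ 2))) * (ρ⁻¹) ^ l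
      ∧ n l ≤ (2 * Real.exp (θ' * (ρ ^ 3 / (1 - ρ ^ 4))) * θ₂
              * ((Real.exp (θ' * (ρ ^ 3 / (1 - ρ ^ 4))) * m 0) * (ρ ^ (2 * k + 1) / (1 - ρ ^ 2))
                + (cB0 + cA * ρ ^ (2 * k)) * (ρ ^ 3 / (1 - ρ ^ 4)))) * (ρ⁻¹) ^ l
      ∧ lam l ≤ (cB0 + cA * ρ ^ (2 * k) + cB1 * (2 * Real.exp (θ' * (ρ ^ 3 / (1 - ρ ^ 4))) * θ₂
              * ((Real.exp (θ' * (ρ ^ 3 / (1 - ρ ^ 4))) * m 0) * (ρ ^ (2 * k + 1) / (1 - ρ ^ 2))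
                + (cB0 + cA * ρ ^ (2 * k)) * (ρ ^ 3 / (1 - ρ ^ 4))))) * (ρ⁻¹) ^ l := by
  have he0 : 0 ≤ Real.exp (θ' * (ρ ^ 3 / (1 - ρ ^ 4))) := (Real.exp_pos _).le
  have hρ2 : ρ ^ 2 < 1 := pow_lt_one₀ hρ0.le hρ1 (by norm_num)
  have h12 : 0 < 1 - ρ ^ 2 := by linarith
  have hM0 : 0 ≤ Real.exp (θ' * (ρ ^ 3 / (1 - ρ ^ 4))) * m 0 := mul_nonneg he0 (hm0 0)
  -- the sourceless lines closed (✓F-7c-1), the gradient feed read in B-shape with its anchor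
  have hm : ∀ j ≤ k, m j ≤ (Real.exp (θ' * (ρ ^ 3 / (1 - ρ ^ 4))) * m 0) * ρ ^ j := fun j hj => by
    have := mass_line_le_geom hρ0 hρ1 hθ' κ' m hκ' hm0 hj (fun i hi => hκ'geo i (by omega)) (fun i hi => hmrec i (by omega))
    calc m j ≤ _ := this
      _ = _ := by ring
  have hg : ∀ j ≤ k, g j ≤ (g 0 + θg * Real.exp (θ' * (ρ ^ 3 / (1 - ρ ^ 4))) * m 0 * ρ ^ (2 * k) * (ρ ^ 3 / (1 - ρ ^ 2))) * (ρ⁻¹) ^ j :=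
      fun j hj => by
    have h := grad_line_le_geom_sharp hρ0 hρ1 hθg hθ' K κ' g m hK hκ' hg0 hm0 hKgeo hκ'geo hmrec hgrec hj
    have hc : 0 ≤ θg * Real.exp (θ' * (ρ ^ 3 / (1 - ρ ^ 4))) * m 0 / (1 - ρ ^ 2) :=
      div_nonneg (mul_nonneg (mul_nonneg hθg he0) (hm0 0)) h12.le
    have hfeed := mul_le_mul_of_nonneg_left (pow_feed_le_anchor hρ0 hρ1 hj) hc
    calc g j ≤ (ρ⁻¹) ^ j * g 0 + θg * Real.exp (θ' * (ρ ^ 3 / (1 - ρ ^ 4))) * m 0 * (ρ ^ (4 * k + 3 - 3 * j) / (1 - ρ ^ 2)) := h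
      _ = (ρ⁻¹) ^ j * g 0 + θg * Real.exp (θ' * (ρ ^ 3 / (1 - ρ ^ 4))) * m 0 / (1 - ρ ^ 2) * ρ ^ (4 * k + 3 - 3 * j) := by ring
      _ ≤ (ρ⁻¹) ^ j * g 0 + θg * Real.exp (θ' * (ρ ^ 3 / (1 - ρ ^ 4))) * m 0 / (1 - ρ ^ 2) * (ρ ^ (2 * k) * (ρ ^ 3 * (ρ⁻¹) ^ j)) := by
          linarith
      _ = _ := by ring
  -- the sourced line reads the full field through `y ≤ m + n + lam`
  have hrec : ∀ j < k, n (j + 1) ≤ (ρ + κ' j) * n j + σ j * (m j + n j + lam j) := fun j hj =>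
    (hnrec j hj).trans (by nlinarith [hσ j, hy j hj.le])
  have hcl := n_lam_closure_sharp hρ0 hρ1 hθ' hθ₂ hΘM hwG hwN hwS hM0 hcA hcB0 hcB1 κ' σ n m g lam wM hκ' hσ hn hm0 hg0 hlam hwM0 hκ'geo hσgeo
    hwMgeo hm hg hn0 hrec hrow hsmall hsmallS hcB0sq hcB1sq hcAsq
  intro l hl
  exact ⟨hg l hl, (hcl l hl).1, (hcl l hl).2⟩

/-- ★★★ **THE FULL-FIELD GRADIENT LINE IN THE PURE B-SLOT — THE SCALAR FORM OF THE DISPLAYED ROW (G_j).**  Under the binder list of F-8b-3 `full_two_slot_of_rows`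
VERBATIM (see `n_lam_B_slot_of_rows`) PLUS a sequence `γ` (the full field's covariant-gradient cell letter, `γ_j² = GRADcov_cell(Ỹ_j)`), nonnegative weights
`uG uN uL` and the scalar full-gradient row `γ_j² ≤ uG·g_j² + uN·n_j² + uL·lam_j²` (`j ≤ k`; inhabited with `(uG,uN,uL) = (4, 16d, 8d)` by ✓`sum_cell_covGrad_add_le`
twice on `Ỹ = G̃lin + N + ∇^{cov}Λ`) — for every `l ≤ k`:
`γ_l² ≤ (uG·Ĝ² + uN·Qn♯² + uL·(cB0 + cA·ρ^{2k} + cB1·Qn♯)²)·((ρ⁻¹)^l)²`,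
`Ĝ`, `Qn♯` as in `n_lam_B_slot_of_rows`.  NO A-SLOT: `m 0` enters only through `Ĝ` (anchor `ρ^{2k}`), `Qn♯` (anchor `ρ^{2k+1}`) and `cA·ρ^{2k}`; on `T³` this is
`GRADcov_cell(Ỹ_l) ≤ BG²·Lˡ` with `BG²` ∈ {`wG·GRAD₀`, `η²MASS₀` × windows} — the currency of `hMc₂`'s B-slot. [Balaban1987RG1 (0.4) p.253, scalar form] -/
theorem grad_full_B_slot_of_rows {ρ θ' θg θ₂ ΘM wG wN wS cA cB0 cB1 : ℝ} (hρ0 : 0 < ρ) (hρ1 : ρ < 1) (hθ' : 0 ≤ θ') (hθg : 0 ≤ θg) (hθ₂ : 0 ≤ θ₂)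
    (hΘM : 0 ≤ ΘM) (hwG : 0 ≤ wG) (hwN : 0 ≤ wN) (hwS : 0 ≤ wS) (hcA : 0 ≤ cA) (hcB0 : 0 ≤ cB0) (hcB1 : 0 ≤ cB1)
    (κ' K σ m n g y lam wM : ℕ → ℝ) (hκ' : ∀ j, 0 ≤ κ' j) (hK : ∀ j, 0 ≤ K j) (hσ : ∀ j, 0 ≤ σ j) (hm0 : ∀ j, 0 ≤ m j) (hn : ∀ j, 0 ≤ n j)
    (hg0 : ∀ j, 0 ≤ g j) (hlam : ∀ j, 0 ≤ lam j) (hwM0 : ∀ j, 0 ≤ wM j) {k : ℕ}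
    (hκ'geo : ∀ j < k, κ' j ≤ θ' * ρ ^ (4 * (k - j))) (hKgeo : ∀ j < k, K j ≤ θg * ρ ^ (4 * (k - j)))
    (hσgeo : ∀ j < k, σ j ≤ θ₂ * ρ ^ (2 * (k - j))) (hwMgeo : ∀ j < k, wM j ≤ ΘM * ρ ^ (4 * (k - j)))
    (hmrec : ∀ j < k, m (j + 1) ≤ (ρ + κ' j) * m j) (hgrec : ∀ j < k, g (j + 1) ≤ ρ⁻¹ * g j + K j * m j)
    (hn0 : n 0 = 0) (hnrec : ∀ j < k, n (j + 1) ≤ (ρ + κ' j) * n j + σ j * y j) (hy : ∀ j ≤ k, y j ≤ m j + n j + lam j)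
    (hrow : ∀ j ≤ k, lam j ^ 2 ≤ ∑ i ∈ Finset.range j,
      (ρ⁻¹) ^ (j - i) * (wG * g i ^ 2 + wN * n i ^ 2 + wM i * (m i ^ 2 + n i ^ 2) + wS * σ i ^ 2 * (m i + n i + lam i) ^ 2))
    (hsmall : Real.exp (θ' * (ρ ^ 3 / (1 - ρ ^ 4))) * θ₂ * (1 + cB1) * (ρ ^ 3 / (1 - ρ ^ 4)) ≤ 1 / 2)
    (hsmallS : 12 * wS * θ₂ ^ 2 * (ρ / (1 - ρ)) ≤ 1 / 2)
    (hcB0sq : 2 * wG * (g 0 + θg * Real.exp (θ' * (ρ ^ 3 / (1 - ρ ^ 4))) * m 0 * ρ ^ (2 * k) * (ρ ^ 3 / (1 - ρ ^ 2))) ^ 2 * (ρ / (1 - ρ)) ≤ cB0 ^ 2)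
    (hcB1sq : 2 * (wN * (ρ / (1 - ρ)) + (ΘM + 3 * wS * θ₂ ^ 2) * (ρ ^ 5 / (1 - ρ ^ 5))) ≤ cB1 ^ 2)
    (hcAsq : 2 * ((ΘM + 3 * wS * θ₂ ^ 2) * (Real.exp (θ' * (ρ ^ 3 / (1 - ρ ^ 4))) * m 0) ^ 2) * (ρ / (1 - ρ)) ≤ cA ^ 2)
    (γ : ℕ → ℝ) {uG uN uL : ℝ} (huG : 0 ≤ uG) (huN : 0 ≤ uN) (huL : 0 ≤ uL)
    (hγrow : ∀ j ≤ k, γ j ^ 2 ≤ uG * g j ^ 2 + uN * n j ^ 2 + uL * lam j ^ 2) :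
    ∀ l ≤ k,
      γ l ^ 2 ≤ (uG * (g 0 + θg * Real.exp (θ' * (ρ ^ 3 / (1 - ρ ^ 4))) * m 0 * ρ ^ (2 * k) * (ρ ^ 3 / (1 - ρ ^ 2))) ^ 2
          + uN * (2 * Real.exp (θ' * (ρ ^ 3 / (1 - ρ ^ 4))) * θ₂
              * ((Real.exp (θ' * (ρ ^ 3 / (1 - ρ ^ 4))) * m 0) * (ρ ^ (2 * k + 1) / (1 - ρ ^ 2))
                + (cB0 + cA * ρ ^ (2 * k)) * (ρ ^ 3 / (1 - ρ ^ 4)))) ^ 2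
          + uL * (cB0 + cA * ρ ^ (2 * k) + cB1 * (2 * Real.exp (θ' * (ρ ^ 3 / (1 - ρ ^ 4))) * θ₂
              * ((Real.exp (θ' * (ρ ^ 3 / (1 - ρ ^ 4))) * m 0) * (ρ ^ (2 * k + 1) / (1 - ρ ^ 2))
                + (cB0 + cA * ρ ^ (2 * k)) * (ρ ^ 3 / (1 - ρ ^ 4))))) ^ 2)
        * ((ρ⁻¹) ^ l) ^ 2 := by
  have hlines := n_lam_B_slot_of_rows hρ0 hρ1 hθ' hθg hθ₂ hΘM hwG hwN hwS hcA hcB0 hcB1 κ' K σ m n g y lam wM hκ' hK hσ hm0 hn hg0 hlam hwM0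
    hκ'geo hKgeo hσgeo hwMgeo hmrec hgrec hn0 hnrec hy hrow hsmall hsmallS hcB0sq hcB1sq hcAsq
  intro l hl
  obtain ⟨hgl, hnl, hll⟩ := hlines l hl
  have p1 := weight_sq_le (hg0 l) huG hgl
  have p2 := weight_sq_le (hn l) huN hnl
  have p3 := weight_sq_le (hlam l) huL hll
  calc γ l ^ 2 ≤ uG * g l ^ 2 + uN * n l ^ 2 + uL * lam l ^ 2 := hγrow l hl
    _ ≤ _ := by linarith

/-! ## §5 The `T³` reading of the anchor -/

/-- The `T³` anchor letter: with `ρ = (√L)⁻¹` (`L > 0`), `ρ^{2k} = (Lᵏ)⁻¹` — at the member top `k = K − n` this is `η = eta F n K = (L^{K−n})⁻¹` (★p1 ✓`eta_mul_level`), so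
`ρ^{2k}·√MASS₀` is `ℓ⁻¹`-anchored B-slot currency and `((ρ⁻¹)^l)² = Lˡ` (F-8b-3 `rho_slots_T3`). [folklore] -/
theorem rho_anchor_T3 {L : ℝ} (hL : 0 < L) (k : ℕ) : ((Real.sqrt L)⁻¹) ^ (2 * k) = (L ^ k)⁻¹ := by
  rw [pow_mul, inv_pow, Real.sq_sqrt hL.le, inv_pow]

end Summit.QuantumFields.YangMills.Theorems.Prop7CornerCombLambdaClosureSharp

end
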